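import Literature.AnabelianGeometry.EtaleTheta.Discharge.Sec5Prop53LabelsOrders

/-!
# [EtTh] §5, Proposition 5.3 (iv) over ORDER COORDINATES — a NON-VACUOUS instance form (no "monoid type `ℤ`"
# structure; valid at PERFECT `Φ(A_⊚)`) and the exact logical shape of (iv) — row F-0560

Mochizuki, *The étale theta function and its Frobenioid-theoretic manifestations*, Publ. RIMS **45** (2009), §5,
Prop. 5.3 (iv) p. 325 (PDF p. 99): `Ψ^Φ_{A_⊚}` preserves "the natural surjection `Prime(Φ(A_⊚))^csp ↠ Prime(Φ(A_⊚))^ncsp`"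
("given by considering the irreducible component of the special fiber that contains the cusp(s)"); proof p. 326 (PDF
p. 100): "Suppose that `a ∈ Φ(A_⊚)^csp` is a primary cuspidal element; then there exists a cuspidal element `b ∈ Φ(A_⊚)^csp`
which is coprime to `a` such that `n := b − a` is cuspidally minimal [and] linearly equivalent to a primary non-cuspidal
element `n′ ∈ Φ(A_⊚)^ncsp`; the assignment `𝔞 ↦ 𝔫′` is the natural surjection of (iv)" [cite: MochizukiEtTh2009, Prop 5.3 (iv)
p.325 (PDF p.99); proof p.326 (PDF p.100)]; Prop. 3.2 (i) p. 296 (PDF p. 70) (product-valued factorization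
`Φ(A_⊚) ↪ ∏_𝔭 ℚ_{≥0}`); Prop. 5.1 p. 323 (PDF p. 97) (`Φ(−)` PERFECT).
Cell abc-iut, block F, seat abc-iut-f-127 (gen 2; tranche 127 = F-0738/F-2496/F-0559/F-0561; row **F-0560**
`PreservesCspToNcsp` taken by the 10:42:54Z split with abc-iut-f-128, who assembles F-2497).  PROOF-ONLY companion (no
`def`, no instance, nothing landed is edited) of abc-iut-L2-t4's `FrobenioidThetaDivisors.lean`; it re-runs abc-iut-L6-d1's
`preservesCspToNcsp_of_criterion'` (`Sec5Prop53LabelsR.lean`) with the structure argument `𝔖 : DivisorSupportData' 𝔓`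
replaced by EXPLICIT HYPOTHESIS BINDERS, using abc-iut-f-128's transport lemmas `…_of_ordMap` (`Sec5Prop53LabelsOrders.lean`,
p438690) BY NAME.

WHY.  The instance forms of record of F-0560 — abc-iut-L2-d4's `preservesCspToNcsp_of_criterion` (over `DivisorSupportData`,
uninhabited for every `𝔓`: abc-iut-L6-d1's `FrobenioidThetaDivisorSupportNegative.lean`) and abc-iut-L6-d1's
`preservesCspToNcsp_of_criterion'` (over `DivisorSupportData'`, uninhabited at every §5 datum with PERFECT `Φ(A_⊚)`:
this seat's `isEmpty_divisorSupportData'_of_isPerfect`, p434934, while Prop. 5.1 says `Φ(−)` IS perfect) — are correct but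
VACUOUS at print's own data.  The derivation of (iv) never needs `ℤ_{≥0}`-components.  It needs exactly this:

* **the logical shape of (iv)** (`preservesCspToNcsp_of_invariant`, `preservesCspToNcsp_iff_exists_invariant`): (iv) holds as
  soon as — indeed, if and only if — the surjection `Prime^csp ↠ Prime^ncsp` is CHARACTERISED (`hW`: the situation occurs at
  every cusp; `hCrit`: it pins the value) by SOME relation `S(𝔞, 𝔫)` between primes that `Ψ^Φ_{A_⊚}` carries along (`hS`);
  print's p.326 paragraph is one such `S` ("`a ∈ 𝔞` primary cuspidal, `b` cuspidal coprime to `a`, `b − a` cuspidally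
  minimal and linearly equivalent to a primary `n ∈ 𝔫`");
* for THAT `S`, its `Ψ^Φ`-invariance (`situation_map_of_ordMap`) follows from: a product-valued factorization
  `factor : Φ(A_⊚) → ∏_𝔭 ℚ` (Prop. 3.2 (i); any homomorphism — the `ℚ_{≥0}`-coefficients at a perfect datum) whose orders
  `Ψ^Φ_{A_⊚}` carries along, `ord_{Ψ^Φ𝔭}(Ψ^Φ a) = ord_𝔭(a)` (`hψo`; at monoid type `ℤ` a theorem, L6-d1's `ordOf'_map`); the
  principal elements `P ⊆ Φ(A_⊚)^gp` (F1) preserved by `(Ψ^Φ)^gp` (`hP`, F1-Ψ); and Prop. 5.3 (i) on primes (`hc`) —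
  supports (possibly infinite), coprimality (`coprimeOf'_gpMap_iff_of_ordMap`), cuspidality, finiteness, cardinalities,
  linear equivalence and cuspidal minimality being transported along `Ψ^Φ` (f-128's `…_of_ordMap` lemmas).
RESULTS: **`preservesCspToNcsp_of_orders`** — (iv) under the binders `factor`/`hψo`/`P`/`hP`/`hc` and the two p.326 clauses
read VERBATIM over (`factor`, `P`) with the tree's `IsCuspidalGpOf'`, `CoprimeOf'`, `IsCuspidallyMinimalOf'`, `LinEquivOf`
(L6-d1's `CspToNcspWitnessed'` / `CspToNcspCriterion'` with `𝔖.factor ↦ factor`, `𝔖.principal ↦ P`; GAP-LEDGER G-L2d4-2 is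
where print's criterion is derived from the intersection theory of the chain) — structural data satisfiable at PERFECT
`Φ(A_⊚)` (abc-iut-f-128's chain model `Φ = ⊕_{ℤ ⊔ ℤ} ℚ_{≥0}`).  The new form SUBSUMES the form of record: at
`𝔖 : DivisorSupportData'` the binder `hψo` is L6-d1's THEOREM `ordOf'_map` and the two clauses are `CspToNcspWitnessed' 𝔖` /
`CspToNcspCriterion' 𝔖` on the nose, so that `preservesCspToNcsp_of_criterion' 𝔖 hc hP hW hCrit` is literally
`preservesCspToNcsp_of_orders 𝔓 Ψ ι e 𝔖.factor 𝔖.principal hc (𝔖.ordOf'_map _) hP hW hCrit` (kernel-checked while drafting;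
not re-landed — same statement, gate `dedup.landed`).

HONEST FRAMING: kernel-checked implications about the TYPED data; the p.326 description of the surjection (`hW`, `hCrit`) is
print's claim recorded as binders, asserted nowhere and not decided here; typed ≠ proved; [EtTh] is a refereed paper; no
side taken on [IUTchIII] Cor. 3.12 or on any author.
-/

namespace Literature.AnabelianGeometry.EtaleTheta

open CategoryTheory
open Literature.AlgebraicGeometry.Frobenioids

universe w v v' u u'

namespace FrobenioidThetaDivisors

/-! ### The logical shape of (iv): an invariant characterisation of the surjection -/

section Shape

variable {C : Type u} [Category.{v} C] {D : Type u'} [Category.{v'} D] {𝔉 : ThetaFrobenioid.{w} C D}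
  (𝔓 : DivisorPrimeData 𝔉) (Ψ : C ≌ C) (ι : Ψ.functor.obj 𝔉.Acirc ≅ 𝔉.Acirc)
  (e : 𝔉.PhiAcirc ≃* 𝔉.pre.Mon (𝔉.base.obj (Ψ.functor.obj 𝔉.Acirc)))

/-- **(iv) from ANY `Ψ^Φ`-invariant characterisation of the surjection.**  If a relation `S(𝔞, 𝔫)` between primes of
`Φ(A_⊚)` is carried along by `Ψ^Φ_{A_⊚}` (`hS`), occurs at every cuspidal prime with a non-cuspidal partner (`hW`), and
pins the value of the surjection `Prime^csp ↠ Prime^ncsp` (`hCrit`), then `Ψ^Φ_{A_⊚}` preserves the surjection — given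
Prop. 5.3 (i) on primes (`hc`).  (Print's p.326 paragraph "the assignment `𝔞 ↦ 𝔫′`" is one such `S`.)
[cite: MochizukiEtTh2009, Prop 5.3 (iv) p.325 (PDF p.99); proof p.326 (PDF p.100)] -/
theorem preservesCspToNcsp_of_invariant (hc : CuspPreserved 𝔓 Ψ ι e)
    (S : Primes 𝔉.PhiAcirc → Primes 𝔉.PhiAcirc → Prop)
    (hS : ∀ 𝔞 𝔫, S 𝔞 𝔫 → S (Primes.congr (psiPhi 𝔉 Ψ ι e) 𝔞) (Primes.congr (psiPhi 𝔉 Ψ ι e) 𝔫))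
    (hW : ∀ 𝔞, 𝔓.IsCuspidal 𝔞 → ∃ 𝔫, ¬ 𝔓.IsCuspidal 𝔫 ∧ S 𝔞 𝔫)
    (hCrit : ∀ (𝔞 𝔫 : Primes 𝔉.PhiAcirc) (h𝔞 : 𝔓.IsCuspidal 𝔞) (h𝔫 : ¬ 𝔓.IsCuspidal 𝔫),
      S 𝔞 𝔫 → 𝔓.cspToNcsp ⟨𝔞, h𝔞⟩ = ⟨𝔫, h𝔫⟩) :
    PreservesCspToNcsp 𝔓 Ψ ι e hc := by
  intro 𝔞 h𝔞
  obtain ⟨𝔫, h𝔫, h𝔞𝔫⟩ := hW 𝔞 h𝔞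
  have h𝔫' : ¬ 𝔓.IsCuspidal (Primes.congr (psiPhi 𝔉 Ψ ι e) 𝔫) := fun h => h𝔫 ((hc 𝔫).mp h)
  have e0 : (𝔓.cspToNcsp ⟨𝔞, h𝔞⟩ : Primes 𝔉.PhiAcirc) = 𝔫 :=
    congrArg Subtype.val (hCrit 𝔞 𝔫 h𝔞 h𝔫 h𝔞𝔫)
  have e1 : (𝔓.cspToNcsp ⟨Primes.congr (psiPhi 𝔉 Ψ ι e) 𝔞, (hc 𝔞).mpr h𝔞⟩ : Primes 𝔉.PhiAcirc) =
      Primes.congr (psiPhi 𝔉 Ψ ι e) 𝔫 :=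
    congrArg Subtype.val (hCrit _ _ ((hc 𝔞).mpr h𝔞) h𝔫' (hS 𝔞 𝔫 h𝔞𝔫))
  rw [e1, e0]

/-- **The exact logical shape of Prop. 5.3 (iv).**  `Ψ^Φ_{A_⊚}` preserves the surjection `Prime^csp ↠ Prime^ncsp` if and
only if the surjection admits SOME `Ψ^Φ_{A_⊚}`-invariant characterisation `S` (occurring at every cusp, pinning the value):
the abstract form loses nothing — (iv) itself supplies `S(𝔞, 𝔫) :=` "`𝔞` is cuspidal and `𝔞 ↦ 𝔫`".
[cite: MochizukiEtTh2009, Prop 5.3 (iv) p.325 (PDF p.99); proof p.326 (PDF p.100)] -/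
theorem preservesCspToNcsp_iff_exists_invariant (hc : CuspPreserved 𝔓 Ψ ι e) :
    PreservesCspToNcsp 𝔓 Ψ ι e hc ↔
      ∃ S : Primes 𝔉.PhiAcirc → Primes 𝔉.PhiAcirc → Prop,
        (∀ 𝔞 𝔫, S 𝔞 𝔫 → S (Primes.congr (psiPhi 𝔉 Ψ ι e) 𝔞) (Primes.congr (psiPhi 𝔉 Ψ ι e) 𝔫)) ∧
        (∀ 𝔞, 𝔓.IsCuspidal 𝔞 → ∃ 𝔫, ¬ 𝔓.IsCuspidal 𝔫 ∧ S 𝔞 𝔫) ∧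
        (∀ (𝔞 𝔫 : Primes 𝔉.PhiAcirc) (h𝔞 : 𝔓.IsCuspidal 𝔞) (h𝔫 : ¬ 𝔓.IsCuspidal 𝔫),
          S 𝔞 𝔫 → 𝔓.cspToNcsp ⟨𝔞, h𝔞⟩ = ⟨𝔫, h𝔫⟩) := by
  constructor
  · intro hiv
    refine ⟨fun 𝔞 𝔫 => ∃ h𝔞 : 𝔓.IsCuspidal 𝔞, (𝔓.cspToNcsp ⟨𝔞, h𝔞⟩ : Primes 𝔉.PhiAcirc) = 𝔫,
      ?_, fun 𝔞 h𝔞 => ⟨_, (𝔓.cspToNcsp ⟨𝔞, h𝔞⟩).2, h𝔞, rfl⟩, ?_⟩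
    · rintro 𝔞 𝔫 ⟨h𝔞, rfl⟩
      exact ⟨(hc 𝔞).mpr h𝔞, hiv 𝔞 h𝔞⟩
    · rintro 𝔞 𝔫 h𝔞 h𝔫 ⟨h𝔞₀, h⟩
      exact Subtype.ext h
  · rintro ⟨S, hS, hW, hCrit⟩
    exact preservesCspToNcsp_of_invariant 𝔓 Ψ ι e hc S hS hW hCrit

end Shape

/-! ### Transport of the p.326 situation along `Ψ^Φ` from the transport of orders -/

section Transport

variable {C : Type u} [Category.{v} C] {D : Type u'} [Category.{v'} D] {𝔉 : ThetaFrobenioid.{w} C D}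
  (𝔓 : DivisorPrimeData 𝔉) (factor : 𝔉.PhiAcirc →* (Primes 𝔉.PhiAcirc → Multiplicative ℚ))
  (ψ : 𝔉.PhiAcirc ≃* 𝔉.PhiAcirc)
  (hψo : ∀ (𝔭 : Primes 𝔉.PhiAcirc) (a : 𝔉.PhiAcirc), ordOf' factor (Primes.congr ψ 𝔭) (ψ a) = ordOf' factor 𝔭 a)
include hψo

/-- Coprimality ("`a`, `b` have disjoint supports", p.326 (PDF p.100); supports possibly infinite) is transported along
`ψ^gp` when `ψ` carries the orders along. [cite: MochizukiEtTh2009, Prop 5.3 proof p.326 (PDF p.100)] -/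
theorem coprimeOf'_gpMap_iff_of_ordMap (x y : Algebra.GrothendieckGroup 𝔉.PhiAcirc) :
    CoprimeOf' factor (ThetaFrobenioid.gpMap ψ.toMonoidHom x) (ThetaFrobenioid.gpMap ψ.toMonoidHom y) ↔
      CoprimeOf' factor x y := by
  change Disjoint (suppOf' factor _) (suppOf' factor _) ↔ Disjoint (suppOf' factor x) (suppOf' factor y)
  rw [supp_gpMap_of_ordMap factor ψ hψo, supp_gpMap_of_ordMap factor ψ hψo]
  exact Set.disjoint_image_iff (Primes.congr ψ).injective

/-- **The p.326 situation is carried along by `ψ`.**  If `a ∈ 𝔞` is primary, `n ∈ 𝔫` is primary, `b` is cuspidal and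
coprime to `a`, and `b − a` is cuspidally minimal and linearly equivalent to `n` — all read over the product-valued
factorization `factor` and the principal elements `P` — then the same holds for `ψ a ∈ ψ𝔞`, `ψ b`, `ψ n ∈ ψ𝔫`, provided `ψ`
carries the orders along (`hψo`), preserves cuspidality of primes (`hc`) and `ψ^gp` preserves `P` (`hP`).
[cite: MochizukiEtTh2009, Prop 5.3 proof p.326 (PDF p.100)] -/
theorem situation_map_of_ordMap (hc : ∀ 𝔭, 𝔓.IsCuspidal (Primes.congr ψ 𝔭) ↔ 𝔓.IsCuspidal 𝔭)
    (P : Subgroup (Algebra.GrothendieckGroup 𝔉.PhiAcirc))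
    (hP : ∀ x, ThetaFrobenioid.gpMap ψ.toMonoidHom x ∈ P ↔ x ∈ P)
    {𝔞 𝔫 : Primes 𝔉.PhiAcirc} {a b n : 𝔉.PhiAcirc} (ha : a ∈ 𝔞.carrier) (hn : n ∈ 𝔫.carrier)
    (hbc : IsCuspidalGpOf' 𝔓 factor (Algebra.GrothendieckGroup.of b))
    (hab : CoprimeOf' factor (Algebra.GrothendieckGroup.of a) (Algebra.GrothendieckGroup.of b))
    (hmin : IsCuspidallyMinimalOf' 𝔓 factor P
      (Algebra.GrothendieckGroup.of b * (Algebra.GrothendieckGroup.of a)⁻¹))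
    (hlin : LinEquivOf P (Algebra.GrothendieckGroup.of b * (Algebra.GrothendieckGroup.of a)⁻¹)
      (Algebra.GrothendieckGroup.of n)) :
    ψ a ∈ (Primes.congr ψ 𝔞).carrier ∧ ψ n ∈ (Primes.congr ψ 𝔫).carrier ∧
      IsCuspidalGpOf' 𝔓 factor (Algebra.GrothendieckGroup.of (ψ b)) ∧
      CoprimeOf' factor (Algebra.GrothendieckGroup.of (ψ a)) (Algebra.GrothendieckGroup.of (ψ b)) ∧
      IsCuspidallyMinimalOf' 𝔓 factor P
        (Algebra.GrothendieckGroup.of (ψ b) * (Algebra.GrothendieckGroup.of (ψ a))⁻¹) ∧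
      LinEquivOf P (Algebra.GrothendieckGroup.of (ψ b) * (Algebra.GrothendieckGroup.of (ψ a))⁻¹)
        (Algebra.GrothendieckGroup.of (ψ n)) := by
  have hg : ∀ x : 𝔉.PhiAcirc, Algebra.GrothendieckGroup.of (ψ x) =
      ThetaFrobenioid.gpMap ψ.toMonoidHom (Algebra.GrothendieckGroup.of x) := fun x => by
    rw [ThetaFrobenioid.gpMap_of, MulEquiv.coe_toMonoidHom]
  have hgba : Algebra.GrothendieckGroup.of (ψ b) * (Algebra.GrothendieckGroup.of (ψ a))⁻¹ =
      ThetaFrobenioid.gpMap ψ.toMonoidHom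
        (Algebra.GrothendieckGroup.of b * (Algebra.GrothendieckGroup.of a)⁻¹) := by
    rw [map_mul, map_inv, hg a, hg b]
  refine ⟨DivisorSupportData.map_mem_carrier_congr ψ ha, DivisorSupportData.map_mem_carrier_congr ψ hn,
    ?_, ?_, ?_, ?_⟩
  · rw [hg b]; exact (isCuspidalGp_gpMap_iff_of_ordMap 𝔓 factor ψ hψo hc _).mpr hbc
  · rw [hg a, hg b]; exact (coprimeOf'_gpMap_iff_of_ordMap factor ψ hψo _ _).mpr hab
  · rw [hgba]; exact (isCuspidallyMinimalOf'_gpMap_iff_of_ordMap 𝔓 factor ψ hψo hc P hP _).mpr hmin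
  · rw [hgba, hg n]; exact (linEquivOf_gpMap_iff ψ P hP _ _).mpr hlin

end Transport

/-! ### Proposition 5.3 (iv) over order coordinates -/

section Prop53iv

variable {C : Type u} [Category.{v} C] {D : Type u'} [Category.{v'} D] {𝔉 : ThetaFrobenioid.{w} C D}
  (𝔓 : DivisorPrimeData 𝔉) (Ψ : C ≌ C) (ι : Ψ.functor.obj 𝔉.Acirc ≅ 𝔉.Acirc)
  (e : 𝔉.PhiAcirc ≃* 𝔉.pre.Mon (𝔉.base.obj (Ψ.functor.obj 𝔉.Acirc)))

/-- **[EtTh] Prop. 5.3 (iv), NON-VACUOUS INSTANCE FORM over order coordinates (row F-0560)** — "`Ψ^Φ_{A_⊚}` preserves the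
natural surjection `Prime(Φ(A_⊚))^csp ↠ Prime(Φ(A_⊚))^ncsp`" — from: a product-valued factorization `factor` (Prop. 3.2 (i))
whose orders `Ψ^Φ_{A_⊚}` carries along (`hψo`), the principal elements `P` preserved by `(Ψ^Φ)^gp` (`hP`, F1-Ψ), Prop. 5.3
(i) on primes (`hc`), and the printed description of the surjection (p.326 (PDF p.100)) read over (`factor`, `P`): it occurs
at every cusp (`hW`, L6-d1's `CspToNcspWitnessed'` verbatim) and pins the value (`hCrit`, L6-d1's `CspToNcspCriterion'`
verbatim; GAP-LEDGER G-L2d4-2).  No "monoid type `ℤ`" structure enters, so the structural data are satisfiable at PERFECT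
`Φ(A_⊚)` (Prop. 5.1). [cite: MochizukiEtTh2009, Prop 5.3 (iv) p.325 (PDF p.99); proof p.326 (PDF p.100)] -/
theorem preservesCspToNcsp_of_orders (factor : 𝔉.PhiAcirc →* (Primes 𝔉.PhiAcirc → Multiplicative ℚ))
    (P : Subgroup (Algebra.GrothendieckGroup 𝔉.PhiAcirc)) (hc : CuspPreserved 𝔓 Ψ ι e)
    (hψo : ∀ (𝔭 : Primes 𝔉.PhiAcirc) (a : 𝔉.PhiAcirc),
      ordOf' factor (Primes.congr (psiPhi 𝔉 Ψ ι e) 𝔭) (psiPhi 𝔉 Ψ ι e a) = ordOf' factor 𝔭 a)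
    (hP : ∀ x, ThetaFrobenioid.gpMap (psiPhi 𝔉 Ψ ι e).toMonoidHom x ∈ P ↔ x ∈ P)
    (hW : ∀ 𝔞 : Primes 𝔉.PhiAcirc, 𝔓.IsCuspidal 𝔞 → ∃ (𝔫 : Primes 𝔉.PhiAcirc) (_ : ¬ 𝔓.IsCuspidal 𝔫)
      (a b n : 𝔉.PhiAcirc), a ∈ 𝔞.carrier ∧ n ∈ 𝔫.carrier ∧
        IsCuspidalGpOf' 𝔓 factor (Algebra.GrothendieckGroup.of b) ∧
        CoprimeOf' factor (Algebra.GrothendieckGroup.of a) (Algebra.GrothendieckGroup.of b) ∧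
        IsCuspidallyMinimalOf' 𝔓 factor P
          (Algebra.GrothendieckGroup.of b * (Algebra.GrothendieckGroup.of a)⁻¹) ∧
        LinEquivOf P (Algebra.GrothendieckGroup.of b * (Algebra.GrothendieckGroup.of a)⁻¹)
          (Algebra.GrothendieckGroup.of n))
    (hCrit : ∀ (𝔞 𝔫 : Primes 𝔉.PhiAcirc) (h𝔞 : 𝔓.IsCuspidal 𝔞) (h𝔫 : ¬ 𝔓.IsCuspidal 𝔫) (a b n : 𝔉.PhiAcirc),
      a ∈ 𝔞.carrier → n ∈ 𝔫.carrier →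
      IsCuspidalGpOf' 𝔓 factor (Algebra.GrothendieckGroup.of b) →
      CoprimeOf' factor (Algebra.GrothendieckGroup.of a) (Algebra.GrothendieckGroup.of b) →
      IsCuspidallyMinimalOf' 𝔓 factor P
        (Algebra.GrothendieckGroup.of b * (Algebra.GrothendieckGroup.of a)⁻¹) →
      LinEquivOf P (Algebra.GrothendieckGroup.of b * (Algebra.GrothendieckGroup.of a)⁻¹)
        (Algebra.GrothendieckGroup.of n) →
      𝔓.cspToNcsp ⟨𝔞, h𝔞⟩ = ⟨𝔫, h𝔫⟩) :
    PreservesCspToNcsp 𝔓 Ψ ι e hc := by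
  refine preservesCspToNcsp_of_invariant 𝔓 Ψ ι e hc
    (fun 𝔞 𝔫 => ∃ a b n : 𝔉.PhiAcirc, a ∈ 𝔞.carrier ∧ n ∈ 𝔫.carrier ∧
      IsCuspidalGpOf' 𝔓 factor (Algebra.GrothendieckGroup.of b) ∧
      CoprimeOf' factor (Algebra.GrothendieckGroup.of a) (Algebra.GrothendieckGroup.of b) ∧
      IsCuspidallyMinimalOf' 𝔓 factor P
        (Algebra.GrothendieckGroup.of b * (Algebra.GrothendieckGroup.of a)⁻¹) ∧
      LinEquivOf P (Algebra.GrothendieckGroup.of b * (Algebra.GrothendieckGroup.of a)⁻¹)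
        (Algebra.GrothendieckGroup.of n))
    ?_ ?_ ?_
  · rintro 𝔞 𝔫 ⟨a, b, n, ha, hn, hbc, hab, hmin, hlin⟩
    exact ⟨_, _, _, situation_map_of_ordMap 𝔓 factor (psiPhi 𝔉 Ψ ι e) hψo hc P hP ha hn hbc hab hmin hlin⟩
  · intro 𝔞 h𝔞
    obtain ⟨𝔫, h𝔫, a, b, n, h⟩ := hW 𝔞 h𝔞
    exact ⟨𝔫, h𝔫, a, b, n, h⟩
  · rintro 𝔞 𝔫 h𝔞 h𝔫 ⟨a, b, n, ha, hn, hbc, hab, hmin, hlin⟩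
    exact hCrit 𝔞 𝔫 h𝔞 h𝔫 a b n ha hn hbc hab hmin hlin

end Prop53iv

end FrobenioidThetaDivisors

end Literature.AnabelianGeometry.EtaleTheta
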